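import Mathlib
import HarnessLib
import Summits.Parity.Statement
import Summits.Parity.GeneralizedHardyLittlewood.Theses.ShiftTauberian

/-!
# Assembly of route-Parity-ShiftTauberian (item stmt-Parity-26471)

`Assembly : WindowHL → RobustRigidity → FibrationLift → GeneralizedHardyLittlewood` is literally the route's certified deciding theorem `closes`
(node G2 «ShiftTauberian» (decomp-parity lens-3; rev 1)): windowed HL at θ = 7/30 + robust rigidity in shift space give the d = 1 block, lifted to all d by the fibration lemma.  One line; no mathematics beyond the route file.
-/

namespace Summit.Parity.GeneralizedHardyLittlewood.Theses.ShiftTauberian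

/-- Assembly item stmt-Parity-26471 of route-Parity-ShiftTauberian:
`WindowHL → RobustRigidity → FibrationLift → GeneralizedHardyLittlewood`,
by the route's deciding theorem `closes`. -/
theorem assembly_proof : Assembly :=
  fun h1 h2 h3 => closes h1 h2 h3

end Summit.Parity.GeneralizedHardyLittlewood.Theses.ShiftTauberian
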